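import Summits.PneNP.PneNP.Theses.LyapunovRefutations
import Literature.Computability.MetaComplexity.ResolutionPigeonholeProofs

/-!
Refutation of `PathCompletePHPLowerBound` (stmt-PneNP-10247, route LyapunovRefutations).

The typed certificate lets the node path depend on the WHOLE word (`∀ w, ∃ p`), and the
domination inequalities are only required along that path.  Hence the data-free certificate
"`m` nodes per layer, node `v` carrying the single piece `(1, 𝟙 - e_v)`" is valid for EVERY
unsatisfiable CNF: route the word `w` constantly through a clause it violates.  Its total piece
count is `(numVars + 1) · m`, polynomial in `n` for `PHP^{n+1}_n`, so no `c > 1` works.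
-/

namespace Summit.PneNP.PneNP.Theses.LyapunovRefutations

open scoped BigOperators Topology Manifold Classical MeasureTheory ProbabilityTheory Matrix InnerProductSpace ComplexConjugate ContinuousMap
open Filter Set Function TopologicalSpace MeasureTheory

/-- **Record of the replaced/dropped route item `PathCompletePHPLowerBound`** = stmt-PneNP-10247 (ledger signature verbatim, in
the route file's namespace and `open` context; NOT a route item): after `LyapunovRefutationsPathCompletePHPLowerBound_refuted` (below) closed the
item `refuted` at e13804d292a6, the route repair (`restate` under a new name, or `drop`) removed
this constant from the gate-written Theses file, while the Theorems file below — append-only,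
statement text fixed — still names it ("Unknown identifier" in the full builds of 2026-08-16).
Re-declared here under its original fully-qualified name and definiens solely so that this record
keeps elaborating. FALSE (refuted below). -/
def PathCompletePHPLowerBound : Prop :=
  ∃ c : ℝ, 1 < c ∧ ∀ (n : ℕ) (N : ℕ → ℕ) (P : ℕ → ℕ → List (ℚ × (Fin (Literature.Computability.MetaComplexity.pigeonholeCNF (n + 1) n).length → ℚ))), ((∀ w : ℕ → Bool, ∃ p : ℕ → ℕ, (∀ j ≤ (Literature.Computability.MetaComplexity.pigeonholeCNF (n + 1) n).numVars, p j < N j) ∧ ∀ j < (Literature.Computability.MetaComplexity.pigeonholeCNF (n + 1) n).numVars, ∀ x : ℚ × (Fin (Literature.Computability.MetaComplexity.pigeonholeCNF (n + 1) n).length → ℚ), 0 ≤ x.1 → (∀ i, 0 ≤ x.2 i) → ∀ q' ∈ P (j + 1) (p (j + 1)), ∃ q ∈ P j (p j), q'.1 * (x.1 + ∑ i, if ((j, w j) : ℕ × Bool) ∈ (Literature.Computability.MetaComplexity.pigeonholeCNF (n + 1) n)[i] then x.2 i else 0) + (∑ i, q'.2 i * (if ((j, w j) : ℕ × Bool) ∈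 (Literature.Computability.MetaComplexity.pigeonholeCNF (n + 1) n)[i] then 0 else x.2 i)) ≤ q.1 * x.1 + ∑ i, q.2 i * x.2 i) ∧ (∀ v < N (Literature.Computability.MetaComplexity.pigeonholeCNF (n + 1) n).numVars, ∀ x : ℚ × (Fin (Literature.Computability.MetaComplexity.pigeonholeCNF (n + 1) n).length → ℚ), 0 ≤ x.1 → (∀ i, 0 ≤ x.2 i) → ∃ q ∈ P (Literature.Computability.MetaComplexity.pigeonholeCNF (n + 1) n).numVars v, x.1 ≤ q.1 * x.1 + ∑ i, q.2 i * x.2 i) ∧ (∀ v < N 0, ∀ q ∈ P 0 v, (∑ i, q.2 i) < ((Literature.Computability.MetaComplexity.pigeonholeCNF (n + 1) n).length : ℚ))) → c ^ n ≤ ((∑ j ∈ Finset.range ((Literature.Computability.MetaComplexity.pigeonholeCNF (n + 1) n).numVars + 1), ∑ v ∈ Finset.range (N j), (P j v).length : ℕ) : ℝ)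

end Summit.PneNP.PneNP.Theses.LyapunovRefutations

open Literature.Computability.Complexity Literature.Computability.MetaComplexity
open Finset

namespace Summit.PneNP.PneNP.Theorems

/-- Refutes `LyapunovRefutations.PathCompletePHPLowerBound`: since the typed layered certificate lets the
node path depend on the whole word and only asks for domination along that path, the data-free
certificate with `m = |φ|` nodes per layer and the single piece `(1, 𝟙 - e_v)` at node `v` is valid for
every unsatisfiable CNF (route `w` through a clause it violates); for `PHP^{n+1}_n` it has
`(numVars + 1) · m ≤ 64 n^5` pieces, so no `c > 1` satisfies `c^n ≤` piece count for all `n`;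
witness: `N := fun _ => m`, `P := fun _ v => [(1, fun i => if i = v then 0 else 1)]`, and `n` with
`64 n^5 < c^n`. [folklore] -/
theorem LyapunovRefutationsPathCompletePHPLowerBound_refuted :
    ¬ Summit.PneNP.PneNP.Theses.LyapunovRefutations.PathCompletePHPLowerBound := by
  rintro ⟨c, hc, h⟩
  -- helper: `numVars` is bounded by any strict bound on the occurring variables
  have numVars_le_of_forall_lt : ∀ {φ : CNF ℕ} {B : ℕ},
      (∀ cl ∈ φ, ∀ l ∈ cl, l.1 < B) → φ.numVars ≤ B := by
    intro φ B hB
    unfold CNF.numVars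
    have key : ∀ L : List ℕ, (∀ v ∈ L, v ≤ B) → L.foldr max 0 ≤ B := by
      intro L
      induction L with
      | nil => intro _; simp
      | cons a L ih =>
        intro hL
        simp only [List.foldr_cons]
        exact max_le (hL a (by simp)) (ih fun v hv => hL v (by simp [hv]))
    apply key
    intro v hv
    obtain ⟨l, hl, rfl⟩ := List.mem_map.1 hv
    obtain ⟨cl, hcl, hlc⟩ := List.mem_flatten.1 hl
    exact hB cl hcl l hlc
  -- helper: every variable of `PHP^{k+1}_k` is `< (k+1)^2`
  have numVars_php_le : ∀ k : ℕ, (pigeonholeCNF (k + 1) k).numVars ≤ (k + 1) ^ 2 := by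
    intro k
    apply numVars_le_of_forall_lt
    intro cl hcl l hl
    simp only [pigeonholeCNF, List.mem_append, List.mem_map, List.mem_range, List.mem_flatMap] at hcl
    rcases hcl with ⟨i, hi, rfl⟩ | ⟨j, hj, i', hi', i, hi, rfl⟩
    · simp only [List.mem_map, List.mem_range] at hl
      obtain ⟨j, hj, rfl⟩ := hl
      dsimp only
      nlinarith
    · simp only [List.mem_cons, List.mem_nil_iff, or_false] at hl
      rcases hl with rfl | rfl <;> dsimp only <;> nlinarith
  -- helper: `|PHP^{k+1}_k| ≤ (k+1)^3`
  have length_php_le : ∀ k : ℕ, (pigeonholeCNF (k + 1) k).length ≤ (k + 1) ^ 3 := by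
    intro k
    rw [length_pigeonholeCNF]
    have h2 : (k + 1).choose 2 ≤ (k + 1) ^ 2 := Nat.choose_le_pow _ _
    nlinarith
  -- choose `n ≥ 1` with `64 n^5 < c^n`
  have hlim := tendsto_pow_const_div_const_pow_of_one_lt 5 hc
  have hev : ∀ᶠ k : ℕ in Filter.atTop, (k : ℝ) ^ 5 / c ^ k < 1 / 64 :=
    hlim.eventually (gt_mem_nhds (by norm_num))
  obtain ⟨N₀, hN₀⟩ := Filter.eventually_atTop.1 hev
  set n : ℕ := max N₀ 1 with hn
  have hn1 : 1 ≤ n := le_max_right _ _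
  have hsmall : (n : ℝ) ^ 5 / c ^ n < 1 / 64 := hN₀ n (le_max_left _ _)
  have hcpos : (0 : ℝ) < c ^ n := pow_pos (by linarith) n
  -- the formula and the certificate
  set φ := pigeonholeCNF (n + 1) n with hφ
  set m := φ.length with hm
  let piece : ℕ → ℚ × (Fin φ.length → ℚ) := fun v => (1, fun i => if (i : ℕ) = v then 0 else 1)
  have hcount := h n (fun _ => m) (fun _ v => [piece v]) ?cert
  · -- size of the certificate: (numVars + 1) * m
    have hsum : (∑ j ∈ Finset.range (φ.numVars + 1), ∑ v ∈ Finset.range m, ([piece v]).length)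
        = (φ.numVars + 1) * m := by
      simp [Finset.sum_const, Finset.card_range]
    rw [hsum] at hcount
    have hnv : φ.numVars ≤ (n + 1) ^ 2 := numVars_php_le n
    have hlen : m ≤ (n + 1) ^ 3 := length_php_le n
    have hbound : ((φ.numVars + 1) * m : ℕ) ≤ 64 * n ^ 5 := by
      have h1 : (φ.numVars + 1) * m ≤ ((n + 1) ^ 2 + 1) * (n + 1) ^ 3 :=
        Nat.mul_le_mul (by omega) hlen
      have h2 : ((n + 1) ^ 2 + 1) * (n + 1) ^ 3 ≤ 2 * (n + 1) ^ 5 := by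
        have hsq : (n + 1) ^ 2 + 1 ≤ 2 * (n + 1) ^ 2 := by
          have := Nat.one_le_pow 2 (n + 1) (by omega); omega
        calc ((n + 1) ^ 2 + 1) * (n + 1) ^ 3 ≤ (2 * (n + 1) ^ 2) * (n + 1) ^ 3 :=
              Nat.mul_le_mul_right _ hsq
          _ = 2 * (n + 1) ^ 5 := by ring
      have h3 : (n + 1) ^ 5 ≤ (2 * n) ^ 5 := Nat.pow_le_pow_left (by omega) 5
      calc (φ.numVars + 1) * m ≤ 2 * (n + 1) ^ 5 := h1.trans h2
        _ ≤ 2 * (2 * n) ^ 5 := by omega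
        _ = 64 * n ^ 5 := by ring
    have hbound' : (((φ.numVars + 1) * m : ℕ) : ℝ) ≤ 64 * (n : ℝ) ^ 5 := by exact_mod_cast hbound
    have hlt : 64 * (n : ℝ) ^ 5 < c ^ n := by
      rw [div_lt_iff₀ hcpos] at hsmall
      linarith
    linarith
  -- validity of the certificate
  refine ⟨?path, ?leaf, ?root⟩
  case path =>
    intro w
    -- a clause violated by `w`
    have hunsat : ¬ φ.Satisfiable := pigeonholeCNF_not_satisfiable_holds (by omega)
    have hex : ∃ i₀ : Fin φ.length, ∀ l ∈ φ[i₀], l.eval w = false := by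
      by_contra hall
      apply hunsat
      refine ⟨w, ?_⟩
      simp only [CNF.eval, List.all_eq_true, List.any_eq_true]
      intro cl hcl
      obtain ⟨i, hi, rfl⟩ := List.getElem_of_mem hcl
      by_contra hnone
      apply hall
      refine ⟨⟨i, hi⟩, fun l hl => ?_⟩
      have hl' : l ∈ φ[i] := by simpa [Fin.getElem_fin] using hl
      cases hlv : l.eval w with
      | false => rfl
      | true => exact (hnone ⟨l, hl', hlv⟩).elim
    obtain ⟨i₀, hi₀⟩ := hex
    have hnot : ∀ j : ℕ, ((j, w j) : ℕ × Bool) ∉ φ[i₀] := by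
      intro j hj
      have := hi₀ _ hj
      simp [Literal.eval] at this
    refine ⟨fun _ => (i₀ : ℕ), fun j _ => i₀.isLt, ?_⟩
    intro j _ x _ hx2 q' hq'
    simp only [List.mem_singleton] at hq'
    subst hq'
    refine ⟨piece i₀, by simp, ?_⟩
    simp only [piece, one_mul]
    rw [add_assoc, ← Finset.sum_add_distrib]
    gcongr with i _
    by_cases hi : (i : ℕ) = (i₀ : ℕ)
    · have hii : i = i₀ := Fin.ext hi
      subst hii
      simp only [if_true, zero_mul, add_zero]
      split_ifs with h1
      · exact absurd h1 (hnot j)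
      · exact le_rfl
    · simp only [hi, if_false, one_mul]
      split_ifs with h1 <;> simp
  case leaf =>
    intro v _ x _ hx2
    refine ⟨piece v, by simp, ?_⟩
    simp only [piece, one_mul]
    have : 0 ≤ ∑ i : Fin φ.length, (if (i : ℕ) = v then (0 : ℚ) else 1) * x.2 i :=
      Finset.sum_nonneg fun i _ => by by_cases hi : (i : ℕ) = v <;> simp [hi, hx2 i]
    linarith
  case root =>
    intro v hv q hq
    simp only [List.mem_singleton] at hq
    subst hq
    simp only [piece]
    have hvlt : v < φ.length := hv
    calc (∑ i : Fin φ.length, (if (i : ℕ) = v then (0 : ℚ) else 1))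
        < ∑ _i : Fin φ.length, (1 : ℚ) := by
          apply Finset.sum_lt_sum
          · intro i _; by_cases hi : (i : ℕ) = v <;> simp [hi]
          · exact ⟨⟨v, hvlt⟩, Finset.mem_univ _, by simp⟩
      _ = (φ.length : ℚ) := by simp

end Summit.PneNP.PneNP.Theorems
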